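import Literature.AlgebraicGeometry.Motives.HodgeStructureK3Type
import HarnessLib

/-!
# Real multiplication on Hodge structures of K3 type forces `dim_E V ≥ 3` (van Geemen 2008, Lemma 3.2)

Family `hodge`, layer `Literature/AlgebraicGeometry/Motives`; a sequel to
`Motives/HodgeStructureK3Type` (carriers `HodgeStructure.IsIrreducible`, `IsOfK3Type`, `endAlg`,
`Polarization`, and Zarhin's theorem as the named facts `Zarhin1983_endAlg_isField`,
`Zarhin1983_adjoint_eq_conj`), which is imported and not restated.

Source read verbatim (B. van Geemen, *Real multiplication on K3 surfaces and Kuga–Satake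
varieties*, Michigan Math. J. 56 (2008) 375–399 = arXiv:math/0609839, §§1–3):

* §1 ("K3 type Hodge structures"): "A Hodge structure of K3 type is a simple, polarized, weight two
  Hodge structure `(V, h, ψ)` with `dim V^{2,0} = 1`." (van Geemen's Hodge structures have
  `p, q ≥ 0`; "simple" = no non-trivial sub-Hodge structure = the tree's `IsIrreducible`.)
* §2: "Zarhin showed that for a Hodge structure of K3 type `(V, h, ψ)`, the division algebra
  `End_Hod(V)` is a (commutative) field which is either totally real, in which case we write
  `End_Hod(V) = F` or it is a CM field `E` […] ([Z], Theorem 1.5.1)", and the Notation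
  "`d = dim_ℚ V`, `n = [F : ℚ]`, `m = dim_F V`" (so `d = n m`).
* §3, **Lemma 3.2**: "Let `F` be a totally real field with `[F : ℚ] = n`. Then for any `m ∈ ℤ_{≥3}`
  there exist K3 type Hodge structures `(V, h, ψ)` with `End_Hod(V) = F` and `dim_F V = m`.
  However, there are no such K3 type Hodge structures with `dim_F V ≤ 2`." Proof of the
  non-existence (p. 6): "In case `m = 1` we would have `1 = dim V_ε`, which contradicts the fact
  that the two dimensional subspace `V_2` is a subspace of `V_ε`. If `m = 2` and `End_Hod(V)` were
  equal to `F`, then by Zarhin's theorem we would have `Hdg(V)(ℂ) ≅ SO(2, ℂ)^n` […] and thus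
  `dim_ℚ End_Hod(V) = 2n` which contradicts that `End_Hod(V) = F`."

## Content

* `Vangeemen2008_three_mul_finrank_endAlg_le` — the NON-EXISTENCE half of Lemma 3.2 as a named
  fact (statement only): for `V` finite-dimensional over `ℚ`, `H : HodgeStructure V 2` irreducible
  of K3 type admitting a polarization, if `E = End_Hdg(V) = H.endAlg` is a field all of whose ring
  embeddings `E → ℂ` are real (a totally real field; that it IS a number field is Zarhin's
  Cor. 3.3.6 = `Zarhin1983_endAlg_isField`, kept here as an explicit hypothesis `IsField`), then
  `3 · dim_ℚ E ≤ dim_ℚ V`, i.e. `m = dim_E V = d / n ≥ 3` (`V` is an `E`-vector space, `d = n m`).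
* Proved consequences, the form used by route HodgeConjecture/EvenB2Twistor (support
  `HighPicardSquares`: "if `rank T(S) ≤ 5` (Picard number `≥ 17`) then `E = ℚ` or `E` is CM"):
  `one_le_finrank_endAlg`; from the fact, `finrank_endAlg_eq_one_of_forall_conj_eq`
  (`dim V ≤ 5`, `E` totally real ⟹ `dim_ℚ E = 1`) and `endAlg_eq_bot_of_forall_conj_eq` (`E = ℚ`,
  i.e. `H.endAlg = ⊥`); `endAlg_eq_bot_or_exists_conj_ne` (`dim V ≤ 5` ⟹ `E = ℚ` or some embedding
  of `E` is not real); and with Zarhin's theorem (`Zarhin1983_adjoint_eq_conj`,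
  `Zarhin1983_endAlg_isField`) `endAlg_eq_bot_or_exists_adjoint_ne` (`dim V ≤ 5` ⟹ `E = ℚ` or the
  adjoint (Rosati) involution of `ψ` is non-trivial on `E` — the CM case, in which it is complex
  conjugation under every embedding).

## Not here

The existence half of Lemma 3.2 (K3 type Hodge structures with `End = F`, `dim_F V = m` for every
`m ≥ 3`), the K3-surface layer (`T(S)_ℚ` of a projective K3 surface is irreducible of K3 type,
Huybrechts Lemma 3.2.7; `rank T(S) = 22 − ρ(S)`; K3 surfaces with real multiplication, van Geemen
§3.4), and Zarhin's real-points description `Hdg(V)(ℝ) ≅ SO(2, m−2) × SO(m)^{n−1}` used in van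
Geemen's proof.

## References

* [Vangeemen2008] B. van Geemen, Real multiplication on K3 surfaces and Kuga–Satake varieties,
  Michigan Math. J. 56 (2008), Lemma 3.2 (and §1, §2 for the conventions).
* [Zarhin1983HodgeGroupsK3] Yu. G. Zarhin, Hodge groups of K3 surfaces, J. reine angew. Math. 341
  (1983), Thm. 1.5.1 (through `HodgeStructureK3Type`).
* [Huybrechts2016K3] D. Huybrechts, Lectures on K3 Surfaces (CUP 2016), Ch. 3 (carriers).
-/

noncomputable section

universe u

namespace Literature.AlgebraicGeometry.Motives

namespace HodgeStructure

variable {V : Type u} [AddCommGroup V] [Module ℚ V]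

/-! ### van Geemen's Lemma 3.2 (named fact) -/

/-- **van Geemen 2008, Lemma 3.2 (non-existence half; after Zarhin): a Hodge structure of K3 type
with real multiplication by the totally real field `E = End_Hdg(V)` has `dim_E V ≥ 3`.** Printed:
"Let `F` be a totally real field with `[F : ℚ] = n`. Then for any `m ∈ ℤ_{≥3}` there exist K3 type
Hodge structures `(V, h, ψ)` with `End_Hod(V) = F` and `dim_F V = m`. However, there are no such K3
type Hodge structures with `dim_F V ≤ 2`" — where (§1) "a Hodge structure of K3 type is a simple,
polarized, weight two Hodge structure `(V, h, ψ)` with `dim V^{2,0} = 1`" and `m = dim_F V = d/n`,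
`d = dim_ℚ V`, `n = [F : ℚ]`. Rendering: for `V` finite-dimensional over `ℚ` and
`H : HodgeStructure V 2` irreducible (`IsIrreducible` = simple) of K3 type (`IsOfK3Type`)
admitting a polarization (`Nonempty H.Polarization`), if `H.endAlg = End_Hdg(V)` is a field
(`IsField`; automatic by `Zarhin1983_endAlg_isField`) which is totally real — every ring embedding
`φ : End_Hdg(V) → ℂ` takes real values, `conj (φ a) = φ a` — then
`3 · dim_ℚ End_Hdg(V) ≤ dim_ℚ V` (equivalently `dim_E V ≥ 3`, as `dim_ℚ V = [E : ℚ] · dim_E V`).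
Statement only (the printed proof uses Zarhin's description of `Hdg(V)(ℂ) ≅ SO(m, ℂ)^n`); the
existence half of the lemma is not vendored. [cite: Vangeemen2008, Lemma 3.2] -/
def Vangeemen2008_three_mul_finrank_endAlg_le : Prop :=
  ∀ ⦃V : Type u⦄ [AddCommGroup V] [Module ℚ V] [Module.Finite ℚ V] (H : HodgeStructure V 2),
    H.IsIrreducible → H.IsOfK3Type → Nonempty H.Polarization → IsField H.endAlg →
      (∀ (φ : H.endAlg →+* ℂ) (a : H.endAlg), starRingEnd ℂ (φ a) = φ a) →
        3 * Module.finrank ℚ H.endAlg ≤ Module.finrank ℚ V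

/-! ### Consequences: small rank forces `E = ℚ` or complex multiplication -/

/-- `End_Hdg(V)` contains the scalars, so `dim_ℚ End_Hdg(V) ≥ 1` as soon as `V ≠ 0`.
[cite: Huybrechts2016K3, §3.3.3] -/
theorem one_le_finrank_endAlg [Module.Finite ℚ V] [Nontrivial V] {n : ℤ} (H : HodgeStructure V n) :
    1 ≤ Module.finrank ℚ H.endAlg := by
  haveI : Module.Finite ℚ H.endAlg := finiteDimensional_endAlg H
  exact Module.finrank_pos

section Consequences

variable [Module.Finite ℚ V] {H : HodgeStructure V 2}

/-- **Rank at most `5` and totally real multiplication force `E = ℚ`:** if `dim_ℚ V ≤ 5` and every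
embedding of the field `E = End_Hdg(V)` is real, then `dim_ℚ E = 1` (from `3 · dim E ≤ dim V ≤ 5`
and `dim E ≥ 1`). For the transcendental lattice of a projective K3 surface this is the case
`rank T(S) ≤ 5`, i.e. Picard number `≥ 17`. [cite: Vangeemen2008, Lemma 3.2] -/
theorem Vangeemen2008_three_mul_finrank_endAlg_le.finrank_endAlg_eq_one_of_forall_conj_eq
    (hvG : Vangeemen2008_three_mul_finrank_endAlg_le.{u}) (hirr : H.IsIrreducible)
    (hK3 : H.IsOfK3Type) (ψ : H.Polarization) (hF : IsField H.endAlg)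
    (hreal : ∀ (φ : H.endAlg →+* ℂ) (a : H.endAlg), starRingEnd ℂ (φ a) = φ a)
    (hV : Module.finrank ℚ V ≤ 5) : Module.finrank ℚ H.endAlg = 1 := by
  haveI : Nontrivial V := hirr.nontrivial
  have h3 := hvG H hirr hK3 ⟨ψ⟩ hF hreal
  have h1 := one_le_finrank_endAlg H
  omega

/-- The same conclusion as `E = ℚ`: `End_Hdg(V) = ℚ · id` (`H.endAlg = ⊥`, Mathlib
`Subalgebra.eq_bot_of_finrank_one`). [cite: Vangeemen2008, Lemma 3.2] -/
theorem Vangeemen2008_three_mul_finrank_endAlg_le.endAlg_eq_bot_of_forall_conj_eq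
    (hvG : Vangeemen2008_three_mul_finrank_endAlg_le.{u}) (hirr : H.IsIrreducible)
    (hK3 : H.IsOfK3Type) (ψ : H.Polarization) (hF : IsField H.endAlg)
    (hreal : ∀ (φ : H.endAlg →+* ℂ) (a : H.endAlg), starRingEnd ℂ (φ a) = φ a)
    (hV : Module.finrank ℚ V ≤ 5) : H.endAlg = ⊥ := by
  haveI : Nontrivial V := hirr.nontrivial
  exact Subalgebra.eq_bot_of_finrank_one
    (hvG.finrank_endAlg_eq_one_of_forall_conj_eq hirr hK3 ψ hF hreal hV)

/-- **`dim_ℚ V ≤ 5` ⟹ `E = ℚ` or `E` is not totally real** (so, by Zarhin's dichotomy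
`Zarhin1983_adjoint_eq_conj`, a CM field): either `End_Hdg(V) = ℚ · id` or some ring embedding
`φ : End_Hdg(V) → ℂ` takes a non-real value. The form "Picard number `≥ 17` ⟹ `End_Hdg(T(S))` is
`ℚ` or CM" used for squares of K3 surfaces of high Picard number. [cite: Vangeemen2008, Lemma 3.2] -/
theorem Vangeemen2008_three_mul_finrank_endAlg_le.endAlg_eq_bot_or_exists_conj_ne
    (hvG : Vangeemen2008_three_mul_finrank_endAlg_le.{u}) (hirr : H.IsIrreducible)
    (hK3 : H.IsOfK3Type) (ψ : H.Polarization) (hF : IsField H.endAlg)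
    (hV : Module.finrank ℚ V ≤ 5) :
    H.endAlg = ⊥ ∨ ∃ (φ : H.endAlg →+* ℂ) (a : H.endAlg), starRingEnd ℂ (φ a) ≠ φ a := by
  by_cases hreal : ∀ (φ : H.endAlg →+* ℂ) (a : H.endAlg), starRingEnd ℂ (φ a) = φ a
  · exact Or.inl (hvG.endAlg_eq_bot_of_forall_conj_eq hirr hK3 ψ hF hreal hV)
  · push Not at hreal
    exact Or.inr hreal

/-- **With Zarhin's theorem: `dim_ℚ V ≤ 5` ⟹ `E = ℚ` or the adjoint involution is non-trivial.**
For `H` irreducible of K3 type with polarization `ψ` on `V` of dimension `≤ 5`, either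
`End_Hdg(V) = ℚ · id`, or there are Hodge endomorphisms `a, a'` forming a `ψ`-adjoint pair with
`a' ≠ a` — the CM case of `Zarhin1983_adjoint_eq_conj` (on a CM field the adjoint is complex
conjugation under every embedding, on a totally real one it is the identity).
[cite: Vangeemen2008, Lemma 3.2] -/
theorem Vangeemen2008_three_mul_finrank_endAlg_le.endAlg_eq_bot_or_exists_adjoint_ne
    (hvG : Vangeemen2008_three_mul_finrank_endAlg_le.{u}) (hF : Zarhin1983_endAlg_isField.{u})
    (hZ : Zarhin1983_adjoint_eq_conj.{u}) (hirr : H.IsIrreducible) (hK3 : H.IsOfK3Type)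
    (ψ : H.Polarization) (hV : Module.finrank ℚ V ≤ 5) :
    H.endAlg = ⊥ ∨ ∃ a a' : H.endAlg,
      LinearMap.IsAdjointPair ψ.form ψ.form (a : Module.End ℚ V) (a' : Module.End ℚ V) ∧
        a' ≠ a := by
  rcases hvG.endAlg_eq_bot_or_exists_conj_ne hirr hK3 ψ (hF H hirr hK3).1 hV with h | ⟨φ, a, hφ⟩
  · exact Or.inl h
  · obtain ⟨a', ha'⟩ := (hZ H hirr hK3 ψ).1 a
    refine Or.inr ⟨a, a', ha', fun haa' ↦ hφ ?_⟩
    have key := (hZ H hirr hK3 ψ).2 a a' ha' φ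
    rw [haa'] at key
    exact key.symm

end Consequences

end HodgeStructure

end Literature.AlgebraicGeometry.Motives

end
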